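import Literature.Geometry.Riemannian.L2HarmonicOneFormsVanishing
import HarnessLib

/-!
# A priori estimates for `L²` harmonic `1`-forms under a Sobolev inequality and `Ric ∈ L^{p/2}`
(Carron's habilitation memoir, §4.b, proof of Thm. 4.3: "Sobolev et Kato")

Sixth layer of the proof programme of the named fact
`Literature.Geometry.Riemannian.Carron1999_finrank_l2HarmonicOneForms_le` (Carron 1999 = memoir
Thm. 4.3). The printed proof of Thm. 4.3 (memoir, pp. 23–24) starts from the two facts that an
`L²` harmonic form on a complete manifold satisfies `∇α ∈ L²` with `∫ |∇α|² + ⟨R_k α, α⟩ = 0`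
(§4.a), and that the Sobolev inequality transported to forms by Kato's inequality controls
`‖α‖_{L^{2ν/(ν-2)}}` by `‖∇α‖_{L²}`; the curvature term is then split into a part on a large ball,
where `R_k` is bounded, and a tail of small `L^{ν/2}` norm, which is absorbed ("`T` est limite en
norme des opérateurs `Δ̄^{-1/2} 1_{B_R} R_k 1_{B_R} Δ̄^{-1/2}`"). This file PROVES the resulting
**a priori estimates**, for a connected complete Riemannian manifold `(N, h)` modelled on `ℝ^m`
with `(S_p)` (constant `μ > 0`, `p > 2`) and `∫ |Ric|^{p/2} dV_h < ∞`:

* `exists_isCompact_setLIntegral_compl_lt` — tails of a finite integral are small off a compact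
  set (σ-compactness and dominated convergence);
* `exists_isCompact_apriori` — **there are a compact `K ⊆ N` and a constant `C`, depending only on
  `(N, h, p, μ)`, such that every `α ∈ ℋ¹(N, h)` satisfies
  `‖ |α|² ‖_{L^{p/(p-2)}} ≤ C ∫_K |α|² dV_h` and `∫_N |∇α|² dV_h ≤ C ∫_K |α|² dV_h`**; in particular
  `α ∈ L^{2p/(p-2)}` and `∇α ∈ L²` (`lintegral_rpow_innerDual_lt_top`,
  `lintegral_normSq_covDerivOneForm_lt_top`);
* `integral_normSq_covDerivOneForm_add_integral_ricci_eq_zero` — **the energy identity**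
  `∫ |∇α|² dV_h + ∫ Ric(♯α, ♯α) dV_h = 0` for `α ∈ ℋ¹(N, h)` (memoir §4.a: "on peut justifier la
  formule d'intégration par partie `0 = ⟨α, Δ_k α⟩ = ∫_M |∇α|² + ⟨R_k α, α⟩`"), with the cross
  term of the localised Bochner identity estimated by `abs_innerDual_mvfderiv_sq_le`.

Everything is proved; no definitions, no named facts (D-0026).

## References

* G. Carron, *Formes harmoniques L² sur les variétés riemanniennes non-compactes*, mémoire
  d'habilitation (1999) = Rend. Mat. Appl. (7) 21 (2001), §4.a (proof of Prop. 4.1–4.2) and §4.b,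
  proof of Thm. 4.3 (pp. 23–24 of the author's PDF). [`Carron1999HdR`]
* G. Carron, *L²-cohomologie et inégalités de Sobolev*, Math. Ann. 314 (1999) 613–639.
  [`Carron1999`]
-/

noncomputable section

open Bundle Set Function Filter FiberBundle
open scoped Manifold ContDiff Topology ENNReal NNReal

namespace Literature.Geometry.Riemannian

open _root_.MeasureTheory Literature.Geometry.Lorentzian

/-! ### Tails of a finite integral off compact sets -/

section Tail

open _root_.MeasureTheory

variable {Y : Type*} [TopologicalSpace Y] [SigmaCompactSpace Y] [T2Space Y] [MeasurableSpace Y]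
  [OpensMeasurableSpace Y] (ν : Measure Y)

/-- **Tails of a finite integral are small off a compact set**: on a σ-compact Hausdorff space, if
`∫ f dν < ∞` then for every `ε > 0` there is a compact `K` with `∫_{Y ∖ K} f dν < ε` (dominated
convergence along the compact exhaustion `compactCovering`). [folklore] -/
theorem exists_isCompact_setLIntegral_compl_lt {f : Y → ℝ≥0∞} (hf : Measurable f)
    (hfin : ∫⁻ y, f y ∂ν ≠ ⊤) {ε : ℝ≥0∞} (hε : 0 < ε) :
    ∃ K : Set Y, IsCompact K ∧ ∫⁻ y in Kᶜ, f y ∂ν < ε := by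
  set K : ℕ → Set Y := compactCovering Y with hK
  have hKc : ∀ n, IsCompact (K n) := isCompact_compactCovering Y
  have hKm : ∀ n, MeasurableSet (K n)ᶜ := fun n ↦ (hKc n).isClosed.measurableSet.compl
  set g : ℕ → Y → ℝ≥0∞ := fun n ↦ (K n)ᶜ.indicator f with hg
  have hgm : ∀ n, Measurable (g n) := fun n ↦ hf.indicator (hKm n)
  have hgle : ∀ n, g n ≤ᵐ[ν] f := fun n ↦ ae_of_all _ fun y ↦ indicator_le_self _ _ y
  have hlim : ∀ᵐ y ∂ν, Tendsto (fun n ↦ g n y) atTop (𝓝 0) := by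
    refine ae_of_all _ fun y ↦ ?_
    obtain ⟨n₀, hn₀⟩ : ∃ n, y ∈ K n := by
      have : y ∈ ⋃ n, K n := by rw [hK, iUnion_compactCovering]; trivial
      exact mem_iUnion.1 this
    refine tendsto_const_nhds.congr' ?_
    refine (eventually_ge_atTop n₀).mono fun n hn ↦ ?_
    have hy : y ∈ K n := compactCovering_subset Y hn hn₀
    simp [hg, indicator_of_notMem (notMem_compl_iff.2 hy)]
  have ht : Tendsto (fun n ↦ ∫⁻ y, g n y ∂ν) atTop (𝓝 (∫⁻ _ : Y, (0 : ℝ≥0∞) ∂ν)) :=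
    tendsto_lintegral_of_dominated_convergence f hgm hgle hfin hlim
  rw [lintegral_zero] at ht
  obtain ⟨n, hn⟩ := ((tendsto_order.1 ht).2 ε hε).exists
  refine ⟨K n, hKc n, ?_⟩
  rwa [hg, lintegral_indicator (hKm n)] at hn

end Tail

/-! ### The a priori estimates -/

section Energy

open _root_.MeasureTheory

universe uH uN

variable {m : ℕ} {H' : Type uH} [TopologicalSpace H']
  {J : ModelWithCorners ℝ (EuclideanSpace ℝ (Fin m)) H'} [J.Boundaryless]
  {N : Type uN} [TopologicalSpace N] [ChartedSpace H' N] [IsManifold J ∞ N]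
  [T3Space N] [SecondCountableTopology N] [MeasurableSpace N] [BorelSpace N] [ConnectedSpace N]
  (h : ContMDiffRiemannianMetric J ∞ (EuclideanSpace ℝ (Fin m)) (TangentSpace J : N → Type _))
  [(PseudoRiemannianMetric.ofRiemannian h).HasLeviCivita]

/-- Arithmetic of the limiting constant: `2 (M I + (μ/16)(16M/(3μ)) I) = (8M/3) I`. [folklore] -/
theorem apriori_limit_aux {μ : ℝ} (hμ : μ ≠ 0) (M I : ℝ) :
    4 * 0 + 2 * (M * I + μ / 16 * (16 * M / (3 * μ) * I)) = 8 * M / 3 * I := by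
  field_simp
  ring

/-- **A priori estimates for `L²` harmonic `1`-forms** (Carron 1999HdR, §4.b, proof of Thm. 4.3,
first step; §4.a, proofs of Prop. 4.1–4.2). Let `(N, h)` be a connected complete Riemannian
manifold modelled on `ℝ^m` with the Sobolev inequality `(S_p)` (constant `μ > 0`, `p > 2`) and
`∫ |Ric|^{p/2} dV_h < ∞` (`|Ric|² = normSq Ric`). Then there are a compact set `K ⊆ N` and a
constant `C ≥ 0`, depending only on `(N, h, p, μ)`, such that for every `α ∈ ℋ¹(N, h)`

  `(∫_N (|α|²)^{p/(p-2)} dV_h)^{1-2/p} ≤ C ∫_K |α|² dV_h`  and  `∫_N |∇α|² dV_h ≤ C ∫_K |α|² dV_h`.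

Proof: choose `K` with `‖ |Ric| ‖_{L^{p/2}(N ∖ K)} ≤ μ/16` (`exists_isCompact_setLIntegral_compl_lt`)
and let `M = sup_K |Ric|`; for the Gaffney cut-offs `χ_k` the localised Sobolev–Bochner estimate
(`sobolev_cutoff_estimate`) reads `μ S_k ≤ 10 C₀‖α‖²/(k+1)² + 4 ∫ |Ric| χ_k²|α|²` with
`S_k = ‖χ_k²|α|²‖_{L^{p/(p-2)}}`, and `∫ |Ric| χ_k²|α|² ≤ M ∫_K |α|² + (μ/16) S_k` (Hölder on
`N ∖ K`, `setLIntegral_ricci_mul_le`); absorb and let `k → ∞` (Fatou). The energy bound follows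
from the Caccioppoli inequality `∫ χ_k²|∇α|² ≤ 4∫|dχ_k|²|α|² - 2∫χ_k² Ric(♯α,♯α)` in the same way.
[cite: Carron1999HdR, §4.b, Thm. 4.3 (proof)] -/
theorem exists_isCompact_apriori {p μ : ℝ} (hp : 2 < p) (hμ : 0 < μ)
    (hc : IsGeodesicallyComplete (PseudoRiemannianMetric.ofRiemannian h).leviCivita)
    (hS : HasSobolevInequality h p μ)
    (hRic : ∫⁻ y, ENNReal.ofReal (((PseudoRiemannianMetric.ofRiemannian h).normSq y
        ((PseudoRiemannianMetric.ofRiemannian h).ricci y)) ^ (p / 4)) ∂riemannianMeasure h ≠ ⊤) :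
    ∃ (K : Set N) (C : ℝ), IsCompact K ∧ 0 ≤ C ∧
      ∀ α ∈ l2HarmonicOneForms h,
        (∫⁻ y, ENNReal.ofReal (((PseudoRiemannianMetric.ofRiemannian h).innerDual y
            (α y).toLinearMap (α y).toLinearMap) ^ (p / (p - 2))) ∂riemannianMeasure h) ^
            (1 - 2 / p) ≤
          ENNReal.ofReal (C * ∫ y in K, (PseudoRiemannianMetric.ofRiemannian h).innerDual y
            (α y).toLinearMap (α y).toLinearMap ∂riemannianMeasure h) ∧
        ∫⁻ y, ENNReal.ofReal ((PseudoRiemannianMetric.ofRiemannian h).normSq y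
            ((PseudoRiemannianMetric.ofRiemannian h).covDerivOneForm α y)) ∂riemannianMeasure h ≤
          ENNReal.ofReal (C * ∫ y in K, (PseudoRiemannianMetric.ofRiemannian h).innerDual y
            (α y).toLinearMap (α y).toLinearMap ∂riemannianMeasure h) := by
  classical
  haveI : LocallyCompactSpace N := Manifold.locallyCompact_of_finiteDimensional J
  haveI : SigmaCompactSpace N := sigmaCompactSpace_of_locallyCompact_secondCountable
  set G := PseudoRiemannianMetric.ofRiemannian h with hG
  set ν := riemannianMeasure h with hν
  have hg : G.IsRiemannian := PseudoRiemannianMetric.isRiemannian_ofRiemannian h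
  -- exponents
  have hp0 : 0 < p := by linarith
  have hp2 : 0 < p - 2 := by linarith
  set q : ℝ := p / (p - 2) with hq
  have hq0 : 0 < q := by positivity
  have hr : 1 - 2 / p = 1 / q := by rw [hq]; field_simp
  have hr0 : 0 < 1 - 2 / p := by rw [hr]; positivity
  -- the curvature data
  set nR : N → ℝ := fun y ↦ G.normSq y (G.ricci y) with hnR
  set V : N → ℝ := fun y ↦ Real.sqrt (nR y) with hV
  have hnRs : ContMDiff J 𝓘(ℝ, ℝ) ∞ nR := PseudoRiemannianMetric.contMDiff_normSq_ricci' G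
  have hnRc : Continuous nR := hnRs.continuous
  have hVc : Continuous V := hnRc.sqrt
  have hV0 : ∀ y, 0 ≤ V y := fun y ↦ Real.sqrt_nonneg _
  have hfm : Measurable fun y ↦ ENNReal.ofReal (nR y ^ (p / 4)) :=
    (hnRc.rpow_const fun y ↦ Or.inr (by positivity)).measurable.ennreal_ofReal
  -- Step 0: a compact `K` off which `‖ |Ric| ‖_{L^{p/2}} ≤ μ/16`, and `M = sup_K |Ric|`
  have hε₀ : 0 < ENNReal.ofReal ((μ / 16) ^ (p / 2)) := ENNReal.ofReal_pos.2 (by positivity)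
  obtain ⟨K, hKc, hKtail⟩ := exists_isCompact_setLIntegral_compl_lt ν hfm hRic hε₀
  have hKm : MeasurableSet K := hKc.isClosed.measurableSet
  have htail : (∫⁻ y in Kᶜ, ENNReal.ofReal (nR y ^ (p / 4)) ∂ν) ^ (2 / p) ≤
      ENNReal.ofReal (μ / 16) := by
    have h1 := ENNReal.rpow_le_rpow hKtail.le (by positivity : (0 : ℝ) ≤ 2 / p)
    refine h1.trans (le_of_eq ?_)
    rw [ENNReal.ofReal_rpow_of_nonneg (by positivity) (by positivity), ← Real.rpow_mul (by positivity)]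
    congr 1
    rw [show p / 2 * (2 / p) = 1 by field_simp, Real.rpow_one]
  obtain ⟨M, hM0, hVM⟩ : ∃ M : ℝ, 0 ≤ M ∧ ∀ y ∈ K, V y ≤ M := by
    obtain ⟨B, hB⟩ := hKc.exists_bound_of_continuousOn hVc.continuousOn
    exact ⟨max B 0, le_max_right _ _, fun y hy ↦
      ((Real.norm_eq_abs _ ▸ le_abs_self (V y)).trans (hB y hy)).trans (le_max_left _ _)⟩
  -- the constant
  refine ⟨K, max (16 * M / (3 * μ)) (8 * M / 3), hKc, by positivity, fun α hα ↦ ?_⟩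
  obtain ⟨hs, hL2, hsy, htr⟩ := (mem_l2HarmonicOneForms_iff h).1 hα
  -- the empty manifold
  rcases isEmpty_or_nonempty N with hN | ⟨⟨o⟩⟩
  · constructor <;> simp [lintegral_of_isEmpty, ENNReal.zero_rpow_of_pos hr0]
  -- the pointwise quantities for `α`
  set Nα : N → ℝ := fun y ↦ G.innerDual y (α y).toLinearMap (α y).toLinearMap with hNα
  set Q : N → ℝ := fun y ↦ G.normSq y (G.covDerivOneForm α y) with hQ
  set Rc : N → ℝ := fun y ↦ G.ricci y (G.sharp y (α y).toLinearMap) (G.sharp y (α y).toLinearMap)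
    with hRc
  have hNα0 : ∀ y, 0 ≤ Nα y := fun y ↦ innerDual_self_nonneg (h := h) y _
  have hQ0 : ∀ y, 0 ≤ Q y := fun y ↦ G.normSq_nonneg y hg _
  have hRcle : ∀ y, |Rc y| ≤ V y * Nα y := fun y ↦ abs_apply_sharp_sharp_le G y hg _ _
  have hNs : ContMDiff J 𝓘(ℝ, ℝ) ∞ Nα := fun y ↦ contMDiffAt_innerDual_oneForm G (hs y) (hs y)
  have hNc : Continuous Nα := hNs.continuous
  have hQs : ContMDiff J 𝓘(ℝ, ℝ) ∞ Q := fun y ↦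
    contMDiffAt_normSq_covDerivOneForm G isOpen_univ (mem_univ y) (fun z _ ↦ hs z) (fun z _ ↦ hsy z)
  have hQc : Continuous Q := hQs.continuous
  have hBochner : ∀ y, G.dalembertian Nα y = 2 * Q y + 2 * Rc y := fun y ↦
    dalembertian_innerDual_eq_of_mem_l2HarmonicOneForms h hα y
  have hRcc : Continuous Rc := by
    have hN2 : CMDiff 2 Nα := hNs.of_le (WithTop.coe_le_coe.mpr le_top)
    have : Rc = fun y ↦ (G.dalembertian Nα y - 2 * Q y) / 2 := by
      funext y; rw [hBochner y]; ring
    rw [this]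
    exact ((continuous_dalembertian G hN2).sub (continuous_const.mul hQc)).div_const _
  -- `|α|² ∈ L¹`
  have hNint : Integrable Nα ν := by
    refine ⟨hNc.aestronglyMeasurable, ?_⟩
    rw [hasFiniteIntegral_iff_ofReal (ae_of_all _ hNα0)]
    exact hL2
  set IN : ℝ := ∫ y, Nα y ∂ν with hIN
  have hIN0 : 0 ≤ IN := integral_nonneg hNα0
  set INK : ℝ := ∫ y in K, Nα y ∂ν with hINK
  have hINK0 : 0 ≤ INK := integral_nonneg hNα0
  -- the cut-offs
  obtain ⟨C₀, χ, hχs, hχk, hχ0, hχ1, -, hχev, hχgrad⟩ :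
      ∃ (C₀ : ℝ) (χ : ℕ → N → ℝ), (∀ k, ContMDiff J 𝓘(ℝ, ℝ) ∞ (χ k)) ∧
        (∀ k, HasCompactSupport (χ k)) ∧ (∀ k y, 0 ≤ χ k y) ∧ (∀ k y, χ k y ≤ 1) ∧
        (∀ (k : ℕ) (y : N), G.edist hg o y < ENNReal.ofReal (((k : ℝ) + 1) / 2) → χ k y = 1) ∧
        (∀ y, ∀ᶠ k in atTop, χ k y = 1) ∧
        ∀ k y, G.gradSq (χ k) y ≤ C₀ / ((k : ℝ) + 1) ^ 2 := by
    obtain ⟨C₀, hC₀⟩ := exists_cutoff_seq_of_isGeodesicallyComplete.{0, uH, uN}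
    exact ⟨C₀, hC₀ J N G hg hc o⟩
  have hC₀ : 0 ≤ C₀ := by
    have h1 := hχgrad 0 o
    have h2 : 0 ≤ G.gradSq (χ 0) o := G.gradSq_nonneg hg _ _
    have h3 : C₀ / ((0 : ℕ) + 1 : ℝ) ^ 2 = C₀ := by norm_num
    linarith [h3 ▸ h1]
  have hχc : ∀ k, Continuous (χ k) := fun k ↦ (hχs k).continuous
  have hzero : ∀ k, ∀ y ∉ tsupport (χ k), χ k y = 0 := fun k y hy ↦
    image_eq_zero_of_notMem_tsupport hy
  have hχsq1 : ∀ k y, χ k y ^ 2 ≤ 1 := fun k y ↦ by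
    have := hχ0 k y; have := hχ1 k y; nlinarith
  -- Step 1: the localised Sobolev–Bochner estimate
  set S : ℕ → ℝ≥0∞ := fun k ↦ ∫⁻ y, ENNReal.ofReal ((χ k y ^ 2 * Nα y) ^ q) ∂ν with hSdef
  set W : ℕ → ℝ := fun k ↦ ∫ y, V y * (χ k y ^ 2 * Nα y) ∂ν with hW
  set b : ℕ → ℝ := fun k ↦ 10 * (C₀ / ((k : ℝ) + 1) ^ 2 * IN) with hb
  have hb0 : ∀ k, 0 ≤ b k := fun k ↦
    mul_nonneg (by norm_num) (mul_nonneg (div_nonneg hC₀ (by positivity)) hIN0)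
  have hEst : ∀ k, ENNReal.ofReal μ * S k ^ (1 - 2 / p) ≤ ENNReal.ofReal (b k + 4 * W k) :=
    fun k ↦ sobolev_cutoff_estimate h hp hS hα (hχs k) (hχk k) (hχgrad k)
  have hIW : ∀ k, Integrable (fun y ↦ V y * (χ k y ^ 2 * Nα y)) ν := fun k ↦
    integrable_of_continuous_of_hasCompactSupport h (hVc.mul (((hχc k).pow 2).mul hNc))
      (HasCompactSupport.intro (hχk k) fun y hy ↦ by simp [hzero k y hy])
  have hW0 : ∀ k, 0 ≤ W k := fun k ↦
    integral_nonneg fun y ↦ mul_nonneg (hV0 y) (mul_nonneg (sq_nonneg _) (hNα0 y))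
  -- Step 2: split the curvature term on `K` and `Kᶜ`:  `W k ≤ M ∫_K |α|² + (μ/16) S_k^{1-2/p}`
  have hWsplit : ∀ k, ENNReal.ofReal (W k) ≤
      ENNReal.ofReal (M * INK) + ENNReal.ofReal (μ / 16) * S k ^ (1 - 2 / p) := by
    intro k
    have hF0 : ∀ y, 0 ≤ χ k y ^ 2 * Nα y := fun y ↦ mul_nonneg (sq_nonneg _) (hNα0 y)
    have hFc : Continuous fun y ↦ χ k y ^ 2 * Nα y := ((hχc k).pow 2).mul hNc
    rw [hW, ofReal_integral_eq_lintegral_ofReal (hIW k)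
      (ae_of_all _ fun y ↦ mul_nonneg (hV0 y) (hF0 y)),
      ← lintegral_add_compl (fun y ↦ ENNReal.ofReal (V y * (χ k y ^ 2 * Nα y))) hKm]
    refine add_le_add ?_ ?_
    · -- on `K`: `V ≤ M`, `χ² ≤ 1`
      calc ∫⁻ y in K, ENNReal.ofReal (V y * (χ k y ^ 2 * Nα y)) ∂ν
          ≤ ∫⁻ y in K, ENNReal.ofReal (M * Nα y) ∂ν := by
            refine setLIntegral_mono' hKm fun y hy ↦ ENNReal.ofReal_le_ofReal ?_
            calc V y * (χ k y ^ 2 * Nα y) ≤ M * (χ k y ^ 2 * Nα y) :=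
                  mul_le_mul_of_nonneg_right (hVM y hy) (hF0 y)
              _ ≤ M * (1 * Nα y) :=
                  mul_le_mul_of_nonneg_left (mul_le_mul_of_nonneg_right (hχsq1 k y) (hNα0 y)) hM0
              _ = M * Nα y := by ring
        _ = ENNReal.ofReal (M * INK) := by
            rw [hINK, ← integral_const_mul, ofReal_integral_eq_lintegral_ofReal
              (hNint.integrableOn.integrable.const_mul M)
              (ae_of_all _ fun y ↦ mul_nonneg hM0 (hNα0 y))]
    · -- on `Kᶜ`: Hölder and the choice of `K`
      have hH := setLIntegral_ricci_mul_le h hp hFc.measurable hF0 Kᶜ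
      refine hH.trans ?_
      refine mul_le_mul' htail ?_
      exact ENNReal.rpow_le_rpow (lintegral_mono' Measure.restrict_le_self le_rfl) hr0.le
  -- Step 3: absorb:  `S_k^{1-2/p} ≤ (4/(3μ)) (b_k + 4 M ∫_K |α|²)`
  have hSfin : ∀ k, S k < ⊤ := by
    intro k
    have hcont : Continuous fun y ↦ (χ k y ^ 2 * Nα y) ^ q :=
      (((hχc k).pow 2).mul hNc).rpow_const fun y ↦ Or.inr hq0.le
    refine lintegral_ofReal_lt_top_of_hasCompactSupport h hcont ?_
    exact HasCompactSupport.intro (hχk k) fun y hy ↦ by simp [hzero k y hy, Real.zero_rpow hq0.ne']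
  set cc : ℕ → ℝ := fun k ↦ 4 * (b k + 4 * (M * INK)) / (3 * μ) with hcdef
  have hMI : 0 ≤ M * INK := mul_nonneg hM0 hINK0
  have hc0 : ∀ k, 0 ≤ cc k := fun k ↦
    div_nonneg (mul_nonneg (by norm_num) (add_nonneg (hb0 k) (mul_nonneg (by norm_num) hMI)))
      (by positivity)
  have hTle : ∀ k, S k ^ (1 - 2 / p) ≤ ENNReal.ofReal (cc k) := by
    intro k
    have hT : S k ^ (1 - 2 / p) ≠ ⊤ := ENNReal.rpow_ne_top_of_nonneg hr0.le (hSfin k).ne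
    set t : ℝ := (S k ^ (1 - 2 / p)).toReal with ht
    have htT : S k ^ (1 - 2 / p) = ENNReal.ofReal t := (ENNReal.ofReal_toReal hT).symm
    have ht0 : 0 ≤ t := ENNReal.toReal_nonneg
    have key : ENNReal.ofReal μ * S k ^ (1 - 2 / p) ≤ ENNReal.ofReal (b k) +
        4 * (ENNReal.ofReal (M * INK) + ENNReal.ofReal (μ / 16) * S k ^ (1 - 2 / p)) := by
      calc ENNReal.ofReal μ * S k ^ (1 - 2 / p) ≤ ENNReal.ofReal (b k + 4 * W k) := hEst k
        _ = ENNReal.ofReal (b k) + 4 * ENNReal.ofReal (W k) := by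
            rw [ENNReal.ofReal_add (hb0 k) (by linarith [hW0 k])]
            congr 1
            rw [ENNReal.ofReal_mul (by norm_num : (0 : ℝ) ≤ 4), ENNReal.ofReal_ofNat]
        _ ≤ _ := by gcongr; exact hWsplit k
    rw [htT] at key ⊢
    have hμt : 0 ≤ μ / 16 * t := mul_nonneg (by positivity) ht0
    have h4 : 0 ≤ 4 * (M * INK + μ / 16 * t) := mul_nonneg (by norm_num) (add_nonneg hMI hμt)
    rw [← ENNReal.ofReal_ofNat, ← ENNReal.ofReal_mul hμ.le, ← ENNReal.ofReal_mul (by positivity),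
      ← ENNReal.ofReal_add hMI hμt, ← ENNReal.ofReal_mul (by norm_num),
      ← ENNReal.ofReal_add (hb0 k) h4] at key
    have key' := (ENNReal.ofReal_le_ofReal_iff (add_nonneg (hb0 k) h4)).1 key
    refine ENNReal.ofReal_le_ofReal ?_
    rw [hcdef]
    simp only
    rw [le_div_iff₀ (by positivity)]
    nlinarith
  -- Step 4: `k → ∞`
  have hbt : Tendsto b atTop (𝓝 0) := by
    have h1 : Tendsto (fun k : ℕ ↦ ((k : ℝ) + 1) ^ 2) atTop atTop := by
      refine (tendsto_pow_atTop two_ne_zero).comp ?_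
      exact tendsto_atTop_add_const_right _ 1 tendsto_natCast_atTop_atTop
    have h2 : Tendsto (fun k : ℕ ↦ C₀ / ((k : ℝ) + 1) ^ 2 * IN) atTop (𝓝 0) := by
      have := (tendsto_const_nhds (x := C₀)).div_atTop h1
      simpa using this.mul_const IN
    simpa [hb] using h2.const_mul 10
  set cinf : ℝ := 4 * (0 + 4 * (M * INK)) / (3 * μ) with hcinf
  have hct : Tendsto cc atTop (𝓝 cinf) := by
    simp only [hcdef, hcinf]
    exact (((hbt.add tendsto_const_nhds).const_mul 4).div_const (3 * μ))
  have hcinfeq : cinf = 16 * M / (3 * μ) * INK := by rw [hcinf]; ring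
  -- Step 5 (first estimate): Fatou for `S`
  have hmeas : ∀ k, Measurable fun y ↦ ENNReal.ofReal ((χ k y ^ 2 * Nα y) ^ q) := fun k ↦
    ((((hχc k).pow 2).mul hNc).rpow_const fun y ↦ Or.inr hq0.le).measurable.ennreal_ofReal
  have hev : ∀ y, ∀ᶠ k in atTop,
      ENNReal.ofReal ((χ k y ^ 2 * Nα y) ^ q) = ENNReal.ofReal (Nα y ^ q) :=
    fun y ↦ (hχev y).mono fun k hk ↦ by rw [hk, one_pow, one_mul]
  have hSle : ∀ k, S k ≤ ENNReal.ofReal (cc k) ^ (1 - 2 / p)⁻¹ := by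
    intro k
    have := ENNReal.rpow_le_rpow (hTle k) (inv_pos.2 hr0).le
    rwa [ENNReal.rpow_rpow_inv hr0.ne'] at this
  have hFatou : ∫⁻ y, ENNReal.ofReal (Nα y ^ q) ∂ν ≤ ENNReal.ofReal cinf ^ (1 - 2 / p)⁻¹ := by
    have h1 : ∫⁻ y, ENNReal.ofReal (Nα y ^ q) ∂ν ≤ liminf S atTop :=
      lintegral_le_liminf_of_eventually_eq ν hmeas hev
    have h2 : liminf S atTop ≤ liminf (fun k ↦ ENNReal.ofReal (cc k) ^ (1 - 2 / p)⁻¹) atTop :=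
      liminf_le_liminf (Eventually.of_forall hSle)
    have h3 : Tendsto (fun k ↦ ENNReal.ofReal (cc k) ^ (1 - 2 / p)⁻¹) atTop
        (𝓝 (ENNReal.ofReal cinf ^ (1 - 2 / p)⁻¹)) :=
      ((ENNReal.continuous_rpow_const.tendsto _).comp (ENNReal.tendsto_ofReal hct))
    rw [h3.liminf_eq] at h2
    exact h1.trans h2
  have hFirst : (∫⁻ y, ENNReal.ofReal (Nα y ^ q) ∂ν) ^ (1 - 2 / p) ≤
      ENNReal.ofReal (max (16 * M / (3 * μ)) (8 * M / 3) * INK) := by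
    have := ENNReal.rpow_le_rpow hFatou hr0.le
    rw [ENNReal.rpow_inv_rpow hr0.ne'] at this
    refine this.trans (ENNReal.ofReal_le_ofReal ?_)
    rw [hcinfeq]
    exact mul_le_mul_of_nonneg_right (le_max_left _ _) hINK0
  -- Step 6 (second estimate): the Caccioppoli inequality and Fatou for `|∇α|²`
  have hgradc : ∀ k, Continuous (G.gradSq (χ k)) := fun k ↦
    continuous_innerDual_mvfderiv G ((hχs k).of_le (by norm_num)) ((hχs k).of_le (by norm_num))
  have hIA : ∀ k, Integrable (fun y ↦ χ k y ^ 2 * Q y) ν := fun k ↦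
    integrable_of_continuous_of_hasCompactSupport h (((hχc k).pow 2).mul hQc)
      (HasCompactSupport.intro (hχk k) fun y hy ↦ by simp [hzero k y hy])
  have hIB : ∀ k, Integrable (fun y ↦ G.gradSq (χ k) y * Nα y) ν := fun k ↦
    integrable_of_continuous_of_hasCompactSupport h ((hgradc k).mul hNc)
      (HasCompactSupport.intro (hχk k) fun y hy ↦ by
        rw [PseudoRiemannianMetric.gradSq, mvfderiv_eq_zero_of_notMem_tsupport hy]
        simp [PseudoRiemannianMetric.innerDual])
  have hIR : ∀ k, Integrable (fun y ↦ χ k y ^ 2 * Rc y) ν := fun k ↦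
    integrable_of_continuous_of_hasCompactSupport h (((hχc k).pow 2).mul hRcc)
      (HasCompactSupport.intro (hχk k) fun y hy ↦ by simp [hzero k y hy])
  have hCacc : ∀ k, ∫ y, χ k y ^ 2 * Q y ∂ν ≤
      4 * ∫ y, G.gradSq (χ k) y * Nα y ∂ν - 2 * ∫ y, χ k y ^ 2 * Rc y ∂ν := fun k ↦
    integral_sq_mul_normSq_covDerivOneForm_le h hα (hχs k) (hχk k)
  have hBle : ∀ k, ∫ y, G.gradSq (χ k) y * Nα y ∂ν ≤ C₀ / ((k : ℝ) + 1) ^ 2 * IN := by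
    intro k
    rw [hIN, ← integral_const_mul]
    exact integral_mono (hIB k) (hNint.const_mul _) fun y ↦
      mul_le_mul_of_nonneg_right (hχgrad k y) (hNα0 y)
  have hRW : ∀ k, -∫ y, χ k y ^ 2 * Rc y ∂ν ≤ W k := by
    intro k
    rw [← integral_neg]
    refine integral_mono (hIR k).neg (hIW k) fun y ↦ ?_
    have h1 := hRcle y
    have h2 : 0 ≤ χ k y ^ 2 := sq_nonneg _
    have h3 : -(χ k y ^ 2 * Rc y) ≤ χ k y ^ 2 * |Rc y| := by
      rw [← mul_neg]; exact mul_le_mul_of_nonneg_left (neg_le_abs _) h2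
    calc -(χ k y ^ 2 * Rc y) ≤ χ k y ^ 2 * |Rc y| := h3
      _ ≤ χ k y ^ 2 * (V y * Nα y) := mul_le_mul_of_nonneg_left h1 h2
      _ = V y * (χ k y ^ 2 * Nα y) := by ring
  have hA0 : ∀ k, 0 ≤ ∫ y, χ k y ^ 2 * Q y ∂ν := fun k ↦
    integral_nonneg fun y ↦ mul_nonneg (sq_nonneg _) (hQ0 y)
  -- `∫ χ_k² |∇α|² ≤ e_k := 4 C₀ ‖α‖²/(k+1)² + 2 (M ∫_K |α|² + (μ/16) c_k)`, a real bound
  have hWreal : ∀ k, W k ≤ M * INK + μ / 16 * cc k := by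
    intro k
    have h1 : ENNReal.ofReal (W k) ≤ ENNReal.ofReal (M * INK + μ / 16 * cc k) := by
      calc ENNReal.ofReal (W k)
          ≤ ENNReal.ofReal (M * INK) + ENNReal.ofReal (μ / 16) * S k ^ (1 - 2 / p) := hWsplit k
        _ ≤ ENNReal.ofReal (M * INK) + ENNReal.ofReal (μ / 16) * ENNReal.ofReal (cc k) := by
            gcongr; exact hTle k
        _ = ENNReal.ofReal (M * INK + μ / 16 * cc k) := by
            rw [← ENNReal.ofReal_mul (by positivity), ← ENNReal.ofReal_add hMI
              (mul_nonneg (by positivity) (hc0 k))]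
    exact (ENNReal.ofReal_le_ofReal_iff (add_nonneg hMI (mul_nonneg (by positivity) (hc0 k)))).1 h1
  set e : ℕ → ℝ := fun k ↦ 4 * (C₀ / ((k : ℝ) + 1) ^ 2 * IN) + 2 * (M * INK + μ / 16 * cc k)
    with hedef
  have hAle : ∀ k, ∫⁻ y, ENNReal.ofReal (χ k y ^ 2 * Q y) ∂ν ≤ ENNReal.ofReal (e k) := by
    intro k
    rw [← ofReal_integral_eq_lintegral_ofReal (hIA k)
      (ae_of_all _ fun y ↦ mul_nonneg (sq_nonneg _) (hQ0 y))]
    refine ENNReal.ofReal_le_ofReal ?_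
    simp only [hedef]
    linarith [hCacc k, hBle k, hRW k, hWreal k]
  set einf : ℝ := 4 * 0 + 2 * (M * INK + μ / 16 * cinf) with heinf
  have het : Tendsto e atTop (𝓝 einf) := by
    simp only [hedef, heinf]
    have h1 : Tendsto (fun k : ℕ ↦ ((k : ℝ) + 1) ^ 2) atTop atTop := by
      refine (tendsto_pow_atTop two_ne_zero).comp ?_
      exact tendsto_atTop_add_const_right _ 1 tendsto_natCast_atTop_atTop
    have h2 : Tendsto (fun k : ℕ ↦ C₀ / ((k : ℝ) + 1) ^ 2 * IN) atTop (𝓝 0) := by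
      have := (tendsto_const_nhds (x := C₀)).div_atTop h1
      simpa using this.mul_const IN
    exact (h2.const_mul 4).add ((tendsto_const_nhds.add (hct.const_mul (μ / 16))).const_mul 2)
  have heinfle : einf ≤ max (16 * M / (3 * μ)) (8 * M / 3) * INK := by
    rw [heinf, hcinfeq, apriori_limit_aux hμ.ne' M INK]
    exact mul_le_mul_of_nonneg_right (le_max_right _ _) hINK0
  have hmeasQ : ∀ k, Measurable fun y ↦ ENNReal.ofReal (χ k y ^ 2 * Q y) := fun k ↦
    (((hχc k).pow 2).mul hQc).measurable.ennreal_ofReal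
  have hevQ : ∀ y, ∀ᶠ k in atTop, ENNReal.ofReal (χ k y ^ 2 * Q y) = ENNReal.ofReal (Q y) :=
    fun y ↦ (hχev y).mono fun k hk ↦ by rw [hk, one_pow, one_mul]
  have hSecond : ∫⁻ y, ENNReal.ofReal (Q y) ∂ν ≤
      ENNReal.ofReal (max (16 * M / (3 * μ)) (8 * M / 3) * INK) := by
    have h1 : ∫⁻ y, ENNReal.ofReal (Q y) ∂ν ≤
        liminf (fun k ↦ ∫⁻ y, ENNReal.ofReal (χ k y ^ 2 * Q y) ∂ν) atTop :=
      lintegral_le_liminf_of_eventually_eq ν hmeasQ hevQ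
    have h2 := liminf_le_liminf (f := atTop) (Eventually.of_forall hAle)
    rw [(ENNReal.tendsto_ofReal het).liminf_eq] at h2
    exact (h1.trans h2).trans (ENNReal.ofReal_le_ofReal heinfle)
  exact ⟨hFirst, hSecond⟩

/-- **`α ∈ L^{2p/(p-2)}` for `α ∈ ℋ¹`** under `(S_p)` and `Ric ∈ L^{p/2}` on a connected complete
manifold modelled on `ℝ^m` (Carron 1999HdR, §4.b, proof of Thm. 4.3: the Sobolev inequality and
Kato's inequality control `‖α‖_{L^{2ν/(ν-2)}}`): `∫ (|α|²)^{p/(p-2)} dV_h < ∞`.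
[cite: Carron1999HdR, §4.b, Thm. 4.3 (proof)] -/
theorem lintegral_rpow_innerDual_lt_top {p μ : ℝ} (hp : 2 < p) (hμ : 0 < μ)
    (hc : IsGeodesicallyComplete (PseudoRiemannianMetric.ofRiemannian h).leviCivita)
    (hS : HasSobolevInequality h p μ)
    (hRic : ∫⁻ y, ENNReal.ofReal (((PseudoRiemannianMetric.ofRiemannian h).normSq y
        ((PseudoRiemannianMetric.ofRiemannian h).ricci y)) ^ (p / 4)) ∂riemannianMeasure h ≠ ⊤)
    {α : Π x : N, TangentSpace J x →L[ℝ] ℝ} (hα : α ∈ l2HarmonicOneForms h) :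
    ∫⁻ y, ENNReal.ofReal (((PseudoRiemannianMetric.ofRiemannian h).innerDual y
        (α y).toLinearMap (α y).toLinearMap) ^ (p / (p - 2))) ∂riemannianMeasure h < ⊤ := by
  obtain ⟨K, C, -, -, hK⟩ := exists_isCompact_apriori h hp hμ hc hS hRic
  obtain ⟨h1, -⟩ := hK α hα
  have hr0 : 0 < 1 - 2 / p := by
    have hp0 : 0 < p := by linarith
    rw [sub_pos, div_lt_one hp0]; linarith
  have hfin : (∫⁻ y, ENNReal.ofReal (((PseudoRiemannianMetric.ofRiemannian h).innerDual y
      (α y).toLinearMap (α y).toLinearMap) ^ (p / (p - 2))) ∂riemannianMeasure h) ^ (1 - 2 / p) <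
      ⊤ := lt_of_le_of_lt h1 ENNReal.ofReal_lt_top
  by_contra htop
  rw [not_lt, top_le_iff] at htop
  rw [htop, ENNReal.top_rpow_of_pos hr0] at hfin
  exact lt_irrefl _ hfin

/-- **`∇α ∈ L²` for `α ∈ ℋ¹`** under `(S_p)` and `Ric ∈ L^{p/2}` on a connected complete manifold
modelled on `ℝ^m` (Carron 1999HdR, §4.a, proof of Prop. 4.1, "on peut justifier la formule
d'intégration par partie … `∫_M |∇α|²`"; §4.b, proof of Thm. 4.3): `∫ |∇α|²_h dV_h < ∞`.
[cite: Carron1999HdR, §4.b, Thm. 4.3 (proof)] -/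
theorem lintegral_normSq_covDerivOneForm_lt_top {p μ : ℝ} (hp : 2 < p) (hμ : 0 < μ)
    (hc : IsGeodesicallyComplete (PseudoRiemannianMetric.ofRiemannian h).leviCivita)
    (hS : HasSobolevInequality h p μ)
    (hRic : ∫⁻ y, ENNReal.ofReal (((PseudoRiemannianMetric.ofRiemannian h).normSq y
        ((PseudoRiemannianMetric.ofRiemannian h).ricci y)) ^ (p / 4)) ∂riemannianMeasure h ≠ ⊤)
    {α : Π x : N, TangentSpace J x →L[ℝ] ℝ} (hα : α ∈ l2HarmonicOneForms h) :
    ∫⁻ y, ENNReal.ofReal ((PseudoRiemannianMetric.ofRiemannian h).normSq y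
        ((PseudoRiemannianMetric.ofRiemannian h).covDerivOneForm α y)) ∂riemannianMeasure h < ⊤ := by
  obtain ⟨K, C, -, -, hK⟩ := exists_isCompact_apriori h hp hμ hc hS hRic
  obtain ⟨-, h2⟩ := hK α hα
  exact lt_of_le_of_lt h2 ENNReal.ofReal_lt_top

/-! ### The energy identity `∫ |∇α|² + ∫ Ric(♯α, ♯α) = 0` -/

omit [J.Boundaryless] [T3Space N] [SecondCountableTopology N] [MeasurableSpace N] [BorelSpace N]
  [ConnectedSpace N] in
/-- **The cross term of the localised Bochner identity**: for `χ` and a `1`-form `α` smooth at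
`x`, `|h⁻¹(d(χ²), d|α|²)| ≤ 4 (|dχ|² |α|²)^{1/2} (χ² |∇α|²)^{1/2}` (`d(χ²) = 2χ dχ`, Cauchy–Schwarz
for `h⁻¹` and Kato's inequality `|d|α|²|² ≤ 4|α|²|∇α|²`). [folklore] -/
theorem abs_innerDual_mvfderiv_sq_le {x : N} {χ : N → ℝ} (hχ : ContMDiffAt J 𝓘(ℝ, ℝ) ∞ χ x)
    {α : Π x : N, TangentSpace J x →L[ℝ] ℝ}
    (hα : ContMDiffAt J (J.prod 𝓘(ℝ, EuclideanSpace ℝ (Fin m) →L[ℝ] ℝ)) ∞ (oneFormSection α) x) :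
    |(PseudoRiemannianMetric.ofRiemannian h).innerDual x
        (mvfderiv J (fun y ↦ χ y ^ 2) x).toLinearMap
        (mvfderiv J (fun y ↦ (PseudoRiemannianMetric.ofRiemannian h).innerDual y
          (α y).toLinearMap (α y).toLinearMap) x).toLinearMap| ≤
      4 * Real.sqrt ((PseudoRiemannianMetric.ofRiemannian h).gradSq χ x *
          (PseudoRiemannianMetric.ofRiemannian h).innerDual x (α x).toLinearMap (α x).toLinearMap) *
        Real.sqrt (χ x ^ 2 * (PseudoRiemannianMetric.ofRiemannian h).normSq x
          ((PseudoRiemannianMetric.ofRiemannian h).covDerivOneForm α x)) := by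
  have hkato := kato_sq h le_rfl (by exact_mod_cast le_top) hα
  have hχd : MDifferentiableAt J 𝓘(ℝ, ℝ) χ x := hχ.mdifferentiableAt (by simp)
  have hsq : (fun y ↦ χ y ^ 2) = χ * χ := by funext y; simp [pow_two]
  have hd2 : mvfderiv J (fun y ↦ χ y ^ 2) x = (2 * χ x) • mvfderiv J χ x := by
    rw [hsq, mvfderiv_mul hχd hχd, two_mul, add_smul]
  rw [hd2]
  set G := PseudoRiemannianMetric.ofRiemannian h with hG
  set D := mvfderiv J χ x with hD
  set Mf := mvfderiv J (fun y ↦ G.innerDual y (α y).toLinearMap (α y).toLinearMap) x with hM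
  have hcs := innerDual_sq_le h x D.toLinearMap Mf.toLinearMap
  have hA : 0 ≤ G.innerDual x (α x).toLinearMap (α x).toLinearMap := innerDual_self_nonneg (h := h) x _
  have hDn : 0 ≤ G.innerDual x D.toLinearMap D.toLinearMap := innerDual_self_nonneg (h := h) x _
  have hN : 0 ≤ G.normSq x (G.covDerivOneForm α x) :=
    G.normSq_nonneg x (PseudoRiemannianMetric.isRiemannian_ofRiemannian h) _
  have hlin : G.innerDual x ((2 * χ x) • D).toLinearMap Mf.toLinearMap =
      2 * χ x * G.innerDual x D.toLinearMap Mf.toLinearMap := by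
    simp only [PseudoRiemannianMetric.innerDual, ContinuousLinearMap.toLinearMap_smul,
      LinearMap.smul_apply, smul_eq_mul]
  rw [hlin]
  set K := G.innerDual x D.toLinearMap Mf.toLinearMap with hK
  have h1 : K ^ 2 ≤ G.innerDual x D.toLinearMap D.toLinearMap *
      (4 * G.innerDual x (α x).toLinearMap (α x).toLinearMap * G.normSq x (G.covDerivOneForm α x)) :=
    hcs.trans (mul_le_mul_of_nonneg_left hkato hDn)
  have aux : ∀ (a P R : ℝ), 0 ≤ P → a ^ 2 ≤ 16 * P * R →
      |a| ≤ 4 * Real.sqrt P * Real.sqrt R := by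
    intro a P R hP hle
    have h16 : Real.sqrt 16 = 4 := by
      rw [show (16 : ℝ) = 4 ^ 2 by norm_num, Real.sqrt_sq (by norm_num)]
    calc |a| ≤ Real.sqrt (16 * P * R) := Real.abs_le_sqrt hle
      _ = 4 * Real.sqrt P * Real.sqrt R := by
          rw [Real.sqrt_mul (by positivity), Real.sqrt_mul (by norm_num), h16]
  refine aux _ _ _ (mul_nonneg hDn hA) ?_
  show (2 * χ x * K) ^ 2 ≤ 16 * (G.innerDual x D.toLinearMap D.toLinearMap *
    G.innerDual x (α x).toLinearMap (α x).toLinearMap) * (χ x ^ 2 * G.normSq x (G.covDerivOneForm α x))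
  nlinarith [h1, sq_nonneg (χ x)]

/-- **The energy identity for `L²` harmonic `1`-forms** (Carron 1999HdR, §4.a, proof of Prop. 4.1:
"on peut justifier la formule d'intégration par partie `0 = ⟨α, Δ_k α⟩ = ∫_M |∇α|² + ⟨R_k α, α⟩`";
Carron 2007, proof of Cor. 2.12: "`α ∈ ℋ¹(M)` satisfies the Bochner identity
`∫_M [|∇α|² + Ric(α, α)] dvol = 0`"), here under `(S_p)` and `Ric ∈ L^{p/2}` on a connected
complete manifold modelled on `ℝ^m`, which guarantee `∇α ∈ L²` and `Ric(♯α, ♯α) ∈ L¹`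
(`exists_isCompact_apriori`, Hölder): `|∇α|²` and `Ric(♯α, ♯α)` are integrable and
`∫ |∇α|² dV_h + ∫ Ric(♯α, ♯α) dV_h = 0`. Proof: integrate the Bochner identity against `χ_k²`
(`integral_sq_mul_bochner_eq_neg_integral_innerDual`); the cross term is
`≤ 4 (∫|dχ_k|²|α|²)^{1/2} (∫χ_k²|∇α|²)^{1/2} → 0` (`abs_innerDual_mvfderiv_sq_le`, Cauchy–Schwarz),
and dominated convergence. [cite: Carron1999HdR, §4.a, Prop. 4.1 (proof)] -/
theorem integral_normSq_covDerivOneForm_add_integral_ricci_eq_zero {p μ : ℝ} (hp : 2 < p)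
    (hμ : 0 < μ) (hc : IsGeodesicallyComplete (PseudoRiemannianMetric.ofRiemannian h).leviCivita)
    (hS : HasSobolevInequality h p μ)
    (hRic : ∫⁻ y, ENNReal.ofReal (((PseudoRiemannianMetric.ofRiemannian h).normSq y
        ((PseudoRiemannianMetric.ofRiemannian h).ricci y)) ^ (p / 4)) ∂riemannianMeasure h ≠ ⊤)
    {α : Π x : N, TangentSpace J x →L[ℝ] ℝ} (hα : α ∈ l2HarmonicOneForms h) :
    Integrable (fun y ↦ (PseudoRiemannianMetric.ofRiemannian h).normSq y
        ((PseudoRiemannianMetric.ofRiemannian h).covDerivOneForm α y)) (riemannianMeasure h) ∧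
      Integrable (fun y ↦ (PseudoRiemannianMetric.ofRiemannian h).ricci y
        ((PseudoRiemannianMetric.ofRiemannian h).sharp y (α y).toLinearMap)
        ((PseudoRiemannianMetric.ofRiemannian h).sharp y (α y).toLinearMap)) (riemannianMeasure h) ∧
      ∫ y, (PseudoRiemannianMetric.ofRiemannian h).normSq y
          ((PseudoRiemannianMetric.ofRiemannian h).covDerivOneForm α y) ∂riemannianMeasure h +
        ∫ y, (PseudoRiemannianMetric.ofRiemannian h).ricci y
          ((PseudoRiemannianMetric.ofRiemannian h).sharp y (α y).toLinearMap)
          ((PseudoRiemannianMetric.ofRiemannian h).sharp y (α y).toLinearMap) ∂riemannianMeasure h =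
        0 := by
  classical
  haveI : LocallyCompactSpace N := Manifold.locallyCompact_of_finiteDimensional J
  haveI : IsFiniteMeasureOnCompacts (riemannianMeasure h) :=
    ⟨fun K hK ↦ riemannianVolume_lt_top_of_isCompact_holds h le_rfl hK⟩
  set G := PseudoRiemannianMetric.ofRiemannian h with hG
  set ν := riemannianMeasure h with hν
  have hg : G.IsRiemannian := PseudoRiemannianMetric.isRiemannian_ofRiemannian h
  obtain ⟨hs, hL2, hsy, htr⟩ := (mem_l2HarmonicOneForms_iff h).1 hα
  -- exponents
  have hp0 : 0 < p := by linarith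
  have hp2 : 0 < p - 2 := by linarith
  have hr0 : 0 < 1 - 2 / p := by rw [sub_pos, div_lt_one hp0]; linarith
  -- the pointwise quantities
  set Nα : N → ℝ := fun y ↦ G.innerDual y (α y).toLinearMap (α y).toLinearMap with hNα
  set Q : N → ℝ := fun y ↦ G.normSq y (G.covDerivOneForm α y) with hQ
  set Rc : N → ℝ := fun y ↦ G.ricci y (G.sharp y (α y).toLinearMap) (G.sharp y (α y).toLinearMap)
    with hRc
  set V : N → ℝ := fun y ↦ Real.sqrt (G.normSq y (G.ricci y)) with hV
  have hNα0 : ∀ y, 0 ≤ Nα y := fun y ↦ innerDual_self_nonneg (h := h) y _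
  have hQ0 : ∀ y, 0 ≤ Q y := fun y ↦ G.normSq_nonneg y hg _
  have hV0 : ∀ y, 0 ≤ V y := fun y ↦ Real.sqrt_nonneg _
  have hRcle : ∀ y, |Rc y| ≤ V y * Nα y := fun y ↦ abs_apply_sharp_sharp_le G y hg _ _
  have hNs : ContMDiff J 𝓘(ℝ, ℝ) ∞ Nα := fun y ↦ contMDiffAt_innerDual_oneForm G (hs y) (hs y)
  have hNc : Continuous Nα := hNs.continuous
  have hQs : ContMDiff J 𝓘(ℝ, ℝ) ∞ Q := fun y ↦
    contMDiffAt_normSq_covDerivOneForm G isOpen_univ (mem_univ y) (fun z _ ↦ hs z) (fun z _ ↦ hsy z)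
  have hQc : Continuous Q := hQs.continuous
  have hVc : Continuous V := (PseudoRiemannianMetric.contMDiff_normSq_ricci' G).continuous.sqrt
  have hBochner : ∀ y, G.dalembertian Nα y = 2 * Q y + 2 * Rc y := fun y ↦
    dalembertian_innerDual_eq_of_mem_l2HarmonicOneForms h hα y
  have hRcc : Continuous Rc := by
    have hN2 : CMDiff 2 Nα := hNs.of_le (WithTop.coe_le_coe.mpr le_top)
    have : Rc = fun y ↦ (G.dalembertian Nα y - 2 * Q y) / 2 := by
      funext y; rw [hBochner y]; ring
    rw [this]
    exact ((continuous_dalembertian G hN2).sub (continuous_const.mul hQc)).div_const _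
  -- integrability of `|α|²`, `|∇α|²`, `|Ric| |α|²`, `Ric(♯α, ♯α)`
  have hNint : Integrable Nα ν := by
    refine ⟨hNc.aestronglyMeasurable, ?_⟩
    rw [hasFiniteIntegral_iff_ofReal (ae_of_all _ hNα0)]
    exact hL2
  have hSfin := lintegral_rpow_innerDual_lt_top h hp hμ hc hS hRic hα
  have hEfin := lintegral_normSq_covDerivOneForm_lt_top h hp hμ hc hS hRic hα
  have hQint : Integrable Q ν := by
    refine ⟨hQc.aestronglyMeasurable, ?_⟩
    rw [hasFiniteIntegral_iff_ofReal (ae_of_all _ hQ0)]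
    exact hEfin
  have hVN : ∫⁻ y, ENNReal.ofReal (V y * Nα y) ∂ν < ⊤ := by
    have hH := setLIntegral_ricci_mul_le h hp hNc.measurable hNα0 univ
    rw [Measure.restrict_univ] at hH
    refine lt_of_le_of_lt hH (ENNReal.mul_lt_top ?_ ?_)
    · exact ENNReal.rpow_lt_top_of_nonneg (by positivity) hRic
    · exact ENNReal.rpow_lt_top_of_nonneg hr0.le hSfin.ne
  have hRint : Integrable Rc ν := by
    refine ⟨hRcc.aestronglyMeasurable, ?_⟩
    refine lt_of_le_of_lt ?_ hVN
    refine lintegral_mono fun y ↦ ?_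
    rw [Real.enorm_eq_ofReal_abs]
    exact ENNReal.ofReal_le_ofReal (hRcle y)
  refine ⟨hQint, hRint, ?_⟩
  -- the empty manifold
  rcases isEmpty_or_nonempty N with hN | ⟨⟨o⟩⟩
  · simp [integral_of_isEmpty]
  -- the cut-offs
  obtain ⟨C₀, χ, hχs, hχk, hχ0, hχ1, -, hχev, hχgrad⟩ :
      ∃ (C₀ : ℝ) (χ : ℕ → N → ℝ), (∀ k, ContMDiff J 𝓘(ℝ, ℝ) ∞ (χ k)) ∧
        (∀ k, HasCompactSupport (χ k)) ∧ (∀ k y, 0 ≤ χ k y) ∧ (∀ k y, χ k y ≤ 1) ∧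
        (∀ (k : ℕ) (y : N), G.edist hg o y < ENNReal.ofReal (((k : ℝ) + 1) / 2) → χ k y = 1) ∧
        (∀ y, ∀ᶠ k in atTop, χ k y = 1) ∧
        ∀ k y, G.gradSq (χ k) y ≤ C₀ / ((k : ℝ) + 1) ^ 2 := by
    obtain ⟨C₀, hC₀⟩ := exists_cutoff_seq_of_isGeodesicallyComplete.{0, uH, uN}
    exact ⟨C₀, hC₀ J N G hg hc o⟩
  have hC₀ : 0 ≤ C₀ := by
    have h1 := hχgrad 0 o
    have h2 : 0 ≤ G.gradSq (χ 0) o := G.gradSq_nonneg hg _ _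
    have h3 : C₀ / ((0 : ℕ) + 1 : ℝ) ^ 2 = C₀ := by norm_num
    linarith [h3 ▸ h1]
  have hχc : ∀ k, Continuous (χ k) := fun k ↦ (hχs k).continuous
  have hzero : ∀ k, ∀ y ∉ tsupport (χ k), χ k y = 0 := fun k y hy ↦
    image_eq_zero_of_notMem_tsupport hy
  have hχsq1 : ∀ k y, χ k y ^ 2 ≤ 1 := fun k y ↦ by
    have := hχ0 k y; have := hχ1 k y; nlinarith
  have hgradc : ∀ k, Continuous (G.gradSq (χ k)) := fun k ↦
    continuous_innerDual_mvfderiv G ((hχs k).of_le (by norm_num)) ((hχs k).of_le (by norm_num))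
  have hgrad00 : ∀ k y, 0 ≤ G.gradSq (χ k) y := fun k y ↦ G.gradSq_nonneg hg _ _
  have hgrad0 : ∀ k, ∀ y ∉ tsupport (χ k), G.gradSq (χ k) y = 0 := fun k y hy ↦ by
    rw [PseudoRiemannianMetric.gradSq, mvfderiv_eq_zero_of_notMem_tsupport hy]
    simp [PseudoRiemannianMetric.innerDual]
  set IN : ℝ := ∫ y, Nα y ∂ν with hIN
  have hIN0 : 0 ≤ IN := integral_nonneg hNα0
  set EQ : ℝ := ∫ y, Q y ∂ν with hEQ
  have hEQ0 : 0 ≤ EQ := integral_nonneg hQ0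
  -- Step 1: the localised identity `∫ χ_k² (2Q + 2Rc) = -∫ h⁻¹(d(χ_k²), d|α|²)`
  set F : ℕ → N → ℝ := fun k y ↦ χ k y ^ 2 * (2 * Q y + 2 * Rc y) with hF
  set X : ℕ → ℝ := fun k ↦ ∫ y, G.innerDual y (mvfderiv J (fun z ↦ χ k z ^ 2) y).toLinearMap
    (mvfderiv J Nα y).toLinearMap ∂ν with hX
  have hid : ∀ k, ∫ y, F k y ∂ν = -X k := fun k ↦
    integral_sq_mul_bochner_eq_neg_integral_innerDual h hα (hχs k) (hχk k)
  -- Step 2: `|X k| ≤ 4 (C₀ ‖α‖²/(k+1)²)^{1/2} (∫ |∇α|²)^{1/2}`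
  have hXle : ∀ k, |X k| ≤ 4 * Real.sqrt (C₀ / ((k : ℝ) + 1) ^ 2 * IN) * Real.sqrt EQ := by
    intro k
    set f : N → ℝ := fun y ↦ Real.sqrt (G.gradSq (χ k) y * Nα y) with hf
    set g : N → ℝ := fun y ↦ Real.sqrt (χ k y ^ 2 * Q y) with hgdef
    have hf0 : ∀ y, 0 ≤ f y := fun y ↦ Real.sqrt_nonneg _
    have hg0 : ∀ y, 0 ≤ g y := fun y ↦ Real.sqrt_nonneg _
    have hfc : Continuous f := ((hgradc k).mul hNc).sqrt
    have hgc : Continuous g := (((hχc k).pow 2).mul hQc).sqrt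
    have hfk : HasCompactSupport f := HasCompactSupport.intro (hχk k) fun y hy ↦ by
      simp [hf, hgrad0 k y hy]
    have hgk : HasCompactSupport g := HasCompactSupport.intro (hχk k) fun y hy ↦ by
      simp [hgdef, hzero k y hy]
    have hpt : ∀ y, |G.innerDual y (mvfderiv J (fun z ↦ χ k z ^ 2) y).toLinearMap
        (mvfderiv J Nα y).toLinearMap| ≤ 4 * (f y * g y) := fun y ↦ by
      have := abs_innerDual_mvfderiv_sq_le h ((hχs k) y) (hs y)
      simp only [hf, hgdef]
      linarith [this]
    have hfg : Integrable (fun y ↦ 4 * (f y * g y)) ν :=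
      (integrable_of_continuous_of_hasCompactSupport h (hfc.mul hgc) hfk.mul_right).const_mul 4
    have h1 : |X k| ≤ ∫ y, 4 * (f y * g y) ∂ν := by
      rw [hX]
      refine (abs_integral_le_integral_abs).trans ?_
      exact integral_mono_of_nonneg (ae_of_all _ fun y ↦ abs_nonneg _) hfg (ae_of_all _ hpt)
    have hCS : ∫ y, f y * g y ∂ν ≤ Real.sqrt (∫ y, f y ^ (2 : ℝ) ∂ν) * Real.sqrt (∫ y, g y ^ (2 : ℝ) ∂ν) := by
      have := integral_mul_le_Lp_mul_Lq_of_nonneg (μ := ν) Real.HolderConjugate.two_two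
        (ae_of_all _ hf0) (ae_of_all _ hg0) (hfc.memLp_of_hasCompactSupport (μ := ν) hfk)
        (hgc.memLp_of_hasCompactSupport (μ := ν) hgk)
      simpa [Real.sqrt_eq_rpow] using this
    have hf2 : ∫ y, f y ^ (2 : ℝ) ∂ν ≤ C₀ / ((k : ℝ) + 1) ^ 2 * IN := by
      have he : (fun y ↦ f y ^ (2 : ℝ)) = fun y ↦ G.gradSq (χ k) y * Nα y := by
        funext y
        rw [Real.rpow_two, hf]
        exact Real.sq_sqrt (mul_nonneg (hgrad00 k y) (hNα0 y))
      rw [he, hIN, ← integral_const_mul]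
      refine integral_mono (integrable_of_continuous_of_hasCompactSupport h ((hgradc k).mul hNc)
        (HasCompactSupport.intro (hχk k) fun y hy ↦ by simp [hgrad0 k y hy])) (hNint.const_mul _)
        fun y ↦ mul_le_mul_of_nonneg_right (hχgrad k y) (hNα0 y)
    have hg2 : ∫ y, g y ^ (2 : ℝ) ∂ν ≤ EQ := by
      have he : (fun y ↦ g y ^ (2 : ℝ)) = fun y ↦ χ k y ^ 2 * Q y := by
        funext y
        rw [Real.rpow_two, hgdef]
        exact Real.sq_sqrt (mul_nonneg (sq_nonneg _) (hQ0 y))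
      rw [he, hEQ]
      refine integral_mono (integrable_of_continuous_of_hasCompactSupport h (((hχc k).pow 2).mul hQc)
        (HasCompactSupport.intro (hχk k) fun y hy ↦ by simp [hzero k y hy])) hQint fun y ↦ ?_
      calc χ k y ^ 2 * Q y ≤ 1 * Q y := mul_le_mul_of_nonneg_right (hχsq1 k y) (hQ0 y)
        _ = Q y := one_mul _
    calc |X k| ≤ ∫ y, 4 * (f y * g y) ∂ν := h1
      _ = 4 * ∫ y, f y * g y ∂ν := integral_const_mul _ _
      _ ≤ 4 * (Real.sqrt (∫ y, f y ^ (2 : ℝ) ∂ν) * Real.sqrt (∫ y, g y ^ (2 : ℝ) ∂ν)) := by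
          gcongr
      _ ≤ 4 * (Real.sqrt (C₀ / ((k : ℝ) + 1) ^ 2 * IN) * Real.sqrt EQ) := by
          gcongr
      _ = 4 * Real.sqrt (C₀ / ((k : ℝ) + 1) ^ 2 * IN) * Real.sqrt EQ := by ring
  have hXt : Tendsto X atTop (𝓝 0) := by
    have h1 : Tendsto (fun k : ℕ ↦ ((k : ℝ) + 1) ^ 2) atTop atTop := by
      refine (tendsto_pow_atTop two_ne_zero).comp ?_
      exact tendsto_atTop_add_const_right _ 1 tendsto_natCast_atTop_atTop
    have h2 : Tendsto (fun k : ℕ ↦ C₀ / ((k : ℝ) + 1) ^ 2 * IN) atTop (𝓝 0) := by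
      have := (tendsto_const_nhds (x := C₀)).div_atTop h1
      simpa using this.mul_const IN
    have h3 : Tendsto (fun k : ℕ ↦ 4 * Real.sqrt (C₀ / ((k : ℝ) + 1) ^ 2 * IN) * Real.sqrt EQ)
        atTop (𝓝 0) := by
      have := ((h2.sqrt).const_mul 4).mul_const (Real.sqrt EQ)
      simpa using this
    refine squeeze_zero_norm (fun k ↦ ?_) h3
    rw [Real.norm_eq_abs]
    exact hXle k
  -- Step 3: dominated convergence for the left-hand side
  have hFm : ∀ k, AEStronglyMeasurable (F k) ν := fun k ↦
    (((hχc k).pow 2).mul ((continuous_const.mul hQc).add (continuous_const.mul hRcc))).aestronglyMeasurable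
  have hbound : Integrable (fun y ↦ 2 * Q y + 2 * |Rc y|) ν :=
    (hQint.const_mul 2).add (hRint.abs.const_mul 2)
  have hFle : ∀ k, ∀ᵐ y ∂ν, ‖F k y‖ ≤ 2 * Q y + 2 * |Rc y| := fun k ↦ ae_of_all _ fun y ↦ by
    rw [Real.norm_eq_abs, hF]
    simp only
    rw [abs_mul, abs_of_nonneg (sq_nonneg _)]
    calc χ k y ^ 2 * |2 * Q y + 2 * Rc y| ≤ 1 * |2 * Q y + 2 * Rc y| :=
          mul_le_mul_of_nonneg_right (hχsq1 k y) (abs_nonneg _)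
      _ ≤ 2 * Q y + 2 * |Rc y| := by
          rw [one_mul]
          calc |2 * Q y + 2 * Rc y| ≤ |2 * Q y| + |2 * Rc y| := abs_add_le _ _
            _ = 2 * Q y + 2 * |Rc y| := by
                rw [abs_of_nonneg (by linarith [hQ0 y]), abs_mul, abs_of_pos two_pos]
  have hFlim : ∀ᵐ y ∂ν, Tendsto (fun k ↦ F k y) atTop (𝓝 (2 * Q y + 2 * Rc y)) :=
    ae_of_all _ fun y ↦ tendsto_const_nhds.congr' ((hχev y).mono fun k hk ↦ by
      simp [hF, hk])
  have hLt : Tendsto (fun k ↦ ∫ y, F k y ∂ν) atTop (𝓝 (∫ y, (2 * Q y + 2 * Rc y) ∂ν)) :=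
    tendsto_integral_of_dominated_convergence _ hFm hbound hFle hFlim
  -- Step 4: conclude
  have hLt' : Tendsto (fun k ↦ ∫ y, F k y ∂ν) atTop (𝓝 0) := by
    have : (fun k ↦ ∫ y, F k y ∂ν) = fun k ↦ -X k := funext hid
    rw [this]
    simpa using hXt.neg
  have heq : ∫ y, (2 * Q y + 2 * Rc y) ∂ν = 0 := tendsto_nhds_unique hLt hLt'
  rw [integral_add (hQint.const_mul 2) (hRint.const_mul 2), integral_const_mul,
    integral_const_mul] at heq
  simp only [hQ, hRc] at heq
  linarith

end Energy

end Literature.Geometry.Riemannian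

end
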